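import Mathlib
import Summits.ResolutionOfSingularities.ResolutionOfSingularities.Theorems.RadicialJungCleanModelsCleanLU3CompositeRamified
import HarnessLib

/-!
# Route `RadicialJung`, crux `CleanModels` (stmt-15917), stub `stub_cleanLU3DefectNonDiscrete`, sub-line (C): the INERT branch — the defect
# passes to the unit `u = (g₀ - a^p)/c^p` and lives inside the coarse valuation ring (piece O2 of the lead's brief `Lines/Sketch-brief-Cdiv-subline.md`)

Line `Sketch` rev 24 of crux stmt-ResolutionOfSingularities-15917; lead `res-B-lead-1` g3.  OURS; nothing here proves resolution in
characteristic `p`.  If `g₀ - a^p = c^p · u` (`c ≠ 0`), the substitution `b = a + c·d` (`(a + c d)^p = a^p + c^p d^p`) transports `p`-th-power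
approximations of `g₀` to those of `u` and back, preserving strict improvements for every valuation: so `u` has no best approximation iff `g₀`
has none (`exists_lt_approx_of_generator`).  If moreover `u` is a unit of a COARSENING `O₁ ≥ O` that is residually not a `p`-th power
(the inert branch of ✓ `bestApprox_dichotomy`), every improvement of an approximant `d ∈ O₁` is again in `O₁` (`mem_of_valuation_sub_pow_lt`):
the defect lives on the residue field of `O₁` — the surface `E` when `v₁ = ord_E`.

* `sub_add_mul_pow` — `g₀ - (a + c d)^p = c^p (u - d^p)`.
* `exists_lt_approx_of_generator` — `hdefect` for `g₀` ⟹ `hdefect` for `u`.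
* `valuation_sub_pow_eq_one_of_inert`, `mem_of_valuation_sub_pow_lt` — in the inert branch, `v₁ (u - d^p) = 1` for `d ∈ O₁`, and any `d′` with
  `v (u - d′^p) < v (u - d^p)` lies in `O₁`.
-/

noncomputable section

set_option linter.dupNamespace false -- mandated namespace of this single-conjunct summit

namespace Summit.ResolutionOfSingularities.ResolutionOfSingularities.Theorems.RadicialJung.CleanModels

variable {K : Type} [Field K]

/-- **The substitution `b = a + c d`**: if `g₀ - a^p = c^p u` then `g₀ - (a + c d)^p = c^p (u - d^p)` (characteristic `p`). [folklore] -/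
theorem sub_add_mul_pow (p : ℕ) [hp : Fact p.Prime] [CharP K p] (g₀ a c u d : K) (hu : g₀ - a ^ p = c ^ p * u) :
    g₀ - (a + c * d) ^ p = c ^ p * (u - d ^ p) := by
  rw [add_pow_char, mul_pow, mul_sub, ← hu]; ring

/-- **No best approximation passes to the generator `u`**: if `g₀ - a^p = c^p u` with `c ≠ 0` and every `p`-th-power approximation of `g₀` can
be strictly improved (for the valuation of `O`), then so can every `p`-th-power approximation of `u`. [folklore] -/
theorem exists_lt_approx_of_generator (p : ℕ) [hp : Fact p.Prime] [CharP K p] (O : ValuationSubring K) (g₀ a c u : K) (hc : c ≠ 0)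
    (hu : g₀ - a ^ p = c ^ p * u) (hdefect : ∀ f₀ : K, ∃ f₁ : K, O.valuation (g₀ - f₁ ^ p) < O.valuation (g₀ - f₀ ^ p)) :
    ∀ d : K, ∃ d' : K, O.valuation (u - d' ^ p) < O.valuation (u - d ^ p) := by
  intro d
  obtain ⟨f₁, hf₁⟩ := hdefect (a + c * d)
  refine ⟨(f₁ - a) / c, ?_⟩
  have hcp : c ^ p ≠ 0 := pow_ne_zero _ hc
  have hvcp : 0 < O.valuation (c ^ p) := zero_lt_iff.mpr ((Valuation.ne_zero_iff _).mpr hcp)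
  have e1 : g₀ - f₁ ^ p = c ^ p * (u - ((f₁ - a) / c) ^ p) := by
    have : f₁ = a + c * ((f₁ - a) / c) := by field_simp; ring
    conv_lhs => rw [this]
    exact sub_add_mul_pow p g₀ a c u _ hu
  rw [e1, sub_add_mul_pow p g₀ a c u d hu, map_mul, map_mul] at hf₁
  exact lt_of_mul_lt_mul_left' hf₁

/-- **In the inert branch the remainder of an `O₁`-approximant is an `O₁`-unit**: if `u ∈ O₁` with `v₁ u = 1` is residually not a `p`-th power
(`¬ v₁ (u - d^p) < 1` for `d ∈ O₁`), then `v₁ (u - d^p) = 1` for every `d ∈ O₁`. [folklore] -/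
theorem valuation_sub_pow_eq_one_of_inert (p : ℕ) (O₁ : ValuationSubring K) (u : K) (hu : u ∈ O₁)
    (hres : ∀ d : K, d ∈ O₁ → ¬ O₁.valuation (u - d ^ p) < 1) (d : K) (hd : d ∈ O₁) : O₁.valuation (u - d ^ p) = 1 := by
  have hle : O₁.valuation (u - d ^ p) ≤ 1 := (O₁.valuation_le_one_iff _).mpr (O₁.sub_mem hu (O₁.pow_mem hd _))
  exact le_antisymm hle (not_lt.mp (hres d hd))

/-- **Improvements stay in the coarse ring**: in the inert branch (`u ∈ O₁` residually not a `p`-th power), if `d ∈ O₁` and `d′` approximates `u`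
strictly better than `d` for a valuation ring `O ≤ O₁`, then `d′ ∈ O₁` — otherwise `v₁ (d′^p) > …`: precisely, `d′ ∉ O₁` gives `v₁ (u - d′^p) = v₁ (d′^p) > 1
= v₁ (u - d^p)`, a strict `v₁`-inequality the wrong way, which passes to `v` (✓ `valuation_lt_of_le_of_valuation_lt`). [folklore] -/
theorem mem_of_valuation_sub_pow_lt (p : ℕ) [hp : Fact p.Prime] (O O₁ : ValuationSubring K) (h : O ≤ O₁) (u : K) (hu : u ∈ O₁)
    (hres : ∀ d : K, d ∈ O₁ → ¬ O₁.valuation (u - d ^ p) < 1) (d : K) (hd : d ∈ O₁) (d' : K)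
    (hlt : O.valuation (u - d' ^ p) < O.valuation (u - d ^ p)) : d' ∈ O₁ := by
  by_contra hd'
  have h1 : O₁.valuation (u - d ^ p) = 1 := valuation_sub_pow_eq_one_of_inert p O₁ u hu hres d hd
  -- `v₁ d' > 1`, hence `v₁ (d'^p) > 1 ≥ v₁ u` and `v₁ (u - d'^p) = v₁ (d'^p) > 1`
  have hvd' : 1 < O₁.valuation d' := by
    rw [← not_le, O₁.valuation_le_one_iff]; exact hd'
  have hvd'p : 1 < O₁.valuation (d' ^ p) := by
    rw [map_pow]; exact one_lt_pow₀ hvd' hp.out.ne_zero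
  have hvu : O₁.valuation u ≤ 1 := (O₁.valuation_le_one_iff _).mpr hu
  have hgt : O₁.valuation (u - d ^ p) < O₁.valuation (u - d' ^ p) := by
    rw [h1]
    have hul : O₁.valuation u < O₁.valuation (d' ^ p) := lt_of_le_of_lt hvu hvd'p
    rw [Valuation.map_sub_eq_of_lt_right _ hul]
    exact hvd'p
  have hgt' := valuation_lt_of_le_of_valuation_lt O O₁ h hgt
  exact absurd hlt (not_lt.mpr hgt'.le)

end Summit.ResolutionOfSingularities.ResolutionOfSingularities.Theorems.RadicialJung.CleanModels

end
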